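import Literature.NumberTheory.Automorphic.JacquetLanglandsExistsOfTraceComparison
import HarnessLib

/-!
# Jacquet–Langlands, existence half: the named residual (the inequality half of Gelbart's trace
# identity (10.10), Hilbert–Schmidt form) and the assembly of `jacquetLanglands_transfer_exists`

S. Gelbart, *Automorphic forms on adele groups*, Ann. of Math. Studies 83 (1975), §10: the proof of
Thm. 10.5 (pp. 148–156) realises the transfer `π' ↦ π` of a cusp form `π'` of dimension `> 1` on
`D_𝔸ˣ` as the equivalence `τ ≅ τ'` (p. 152) of two unitary representations of `G^S`, and obtains
that equivalence from

1. **the trace identity** (10.10) `tr τ(f ⋆ f^*) = tr τ'(f ⋆ f^*)`, `f ∈ S(G^S)`, for the operators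
   `τ(f) = R₀^ψ(Φ_f)|_M`, `τ'(f) = R'_ψ(Φ'_f)` ((10.11)–(10.13)) — the comparison of the trace formula
   for the compact quotient of `D^×` (10.14) with the cuspidal trace formula for `GL₂` (10.15), term
   by term (10.16)–(10.22), fed by the local correspondence `π'_v ↦ π_v(π'_v)` (Thm. 7.2/7.6), the
   character identity (10.8) and the orthogonality relations (10.11) for the idempotents `ξ_v` at
   `v ∈ S = Ram(D)`;
2. **Lemma 10.6** (= Jacquet–Langlands, LNM 114, Lemma 16.1.1): a trace identity (indeed the
   inequality `tr τ' ≤ tr τ`) along an ample `*`-algebra forces a non-zero intertwiner from `τ'`.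

Step 2 and the whole representation-theoretic passage from such an intertwiner to the named fact
are PROVED in the tree (`exists_intertwiner_into_of_hilbertSchmidt_le`,
`jacquetLanglands_transfer_exists_of_hilbertSchmidt_le_of_mapsTo_cuspidal` in
`JacquetLanglandsExistsOfTraceComparison`; `JacquetLanglandsExistsOfIntertwiner`). This file names
step 1 — the analytic residual, in the cuspidal form "closest to the printed proof" of
loc. cit. — as a fact of its own and records the assembly:

* `jacquetLanglands_exists_traceComparisonDatum` — for some family of splittings
  `θ₀_v : D_v ≃ₐ M₂(K_v)` (`v ∉ Ram_f(D)`) and every automorphic `πD ≤ L²(D_𝔸ˣ ⧸ ℝ_{>0} Dˣ)` of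
  dimension `≠ 1` (`D` division): Gelbart's data `E = L²₀(ψ)`-like closed `G^S`-invariant subspace
  of `L²(GL₂)`, the family `B ∋ (R₀^ψ(Φ_f), R'_ψ(Φ'_f))`, and Hilbert bases with
  `Σ_j ‖f₂ c_j‖² ≤ Σ_i ‖f₁ b_i‖² < ∞` (the inequality half of (10.10)), first components mapping `E`
  into `L²_cusp` orthogonally to the cuspidal `Π` that are not square-integrable at some
  `v ∈ Ram_f(D)` ((10.11)), second components preserving `πD` and not all zero on it;
* `jacquetLanglands_transfer_exists_holds_of` — the assembly, a direct call to
  `jacquetLanglands_transfer_exists_of_hilbertSchmidt_le_of_mapsTo_cuspidal`.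

## References

* [Gelbart1975] S. Gelbart, *Automorphic forms on adele groups*, Ann. of Math. Studies 83 (1975),
  Thm. 10.5 (i), Lemma 10.6, (10.8)–(10.22), pp. 148–156.
* [JacquetLanglands1970] H. Jacquet, R. P. Langlands, *Automorphic forms on `GL(2)`*, LNM 114
  (1970), §14 Thm. 14.4, §16 Thm. 16.1, Lemma 16.1.1.
-/

noncomputable section

open scoped TensorProduct MatrixGroups NNReal ENNReal InnerProductSpace
open NumberField IsDedekindDomain MeasureTheory TopologicalSpace
open Literature.NumberTheory.Automorphic

universe u

namespace Literature.NumberTheory.Automorphic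

section Split

variable (K : Type) [Field K] [NumberField K] (D : Type u) [Ring D] [Algebra K D]
  [IsQuaternionAlgebra K D]

-- Binder repair (2026-08-16): the header instance deliberately shadows the section's, which a
-- `def` does not capture (it ranged too widely before); the overlapping-instances linter is moot.
set_option linter.overlappingInstances false in
/-- **Gelbart (1975), the inequality half of (10.10) with (10.11)–(10.13), Hilbert–Schmidt form —
the analytic residual of Thm. 10.5 (i).** For some family of algebra splittings
`θ₀_v : D_v ≃ₐ[K_v] M₂(K_v)` at the finite places `v ∉ Ram_f(D)` (they exist by definition of
`Ram_f(D)`; any choice will do), the following holds. Let `D` be a division quaternion algebra over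
`K`, `μ_D`, `μ` automorphic measures, and `πD ≤ L²(D_𝔸ˣ ⧸ ℝ_{>0} Dˣ)` an automorphic representation
of dimension `≠ 1`. Then there are: a closed subspace `E ≤ L²(GL₂(K) ℝ_{>0} \ GL₂(𝔸_K))` invariant
under the `GL₂(K_v)`, `v ∉ Ram_f(D)` finite (Gelbart's `L²₀(ψ)`, (10.13)); a `ℂ`-subspace `B` of
pairs of bounded operators on `L²(GL₂) × L²(D_𝔸ˣ ⧸ ℝ_{>0} Dˣ)` — in the printed proof the
`(R₀^ψ(Φ_f), R'_ψ(Φ'_f))`, `Φ_f = ξ_S ⊗ f`, `Φ'_f = ξ'_S ⊗ f`, `f ∈ S(G^S)` ((10.11)–(10.13)) —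
closed under products, adjoints and left multiplication by the matched local translations
`(R(ι_v g), R_D(ι_v θ₀_v⁻¹ g))`, `g ∈ GL₂(K_v)`, `v ∉ Ram_f(D)`; whose first components preserve `E`
and map it into `L²_cusp(GL₂)` orthogonally to every cuspidal `Π` lacking, at some `v ∈ Ram_f(D)`,
an irreducible admissible local component square-integrable modulo the centre (the orthogonality
relations (10.11): `R₀(Φ_f)` only sees the constituents `πⁱ` with `πⁱ_v ≅ π_v(π'_v)` at `v ∈ S`);
whose second components preserve `πD` and do not all vanish on it; and Hilbert bases `(b_i)` of
`E`, `(c_j)` of `L²(D_𝔸ˣ ⧸ ℝ_{>0} Dˣ)` with `Σ_j ‖f₂ c_j‖² ≤ Σ_i ‖f₁ b_i‖² < ∞` on `B` — "trace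
`R'_ψ(Φ'_f Φ'_f^*)` ≤ trace `R₀^ψ(Φ_f Φ_f^*)`", the inequality half of (10.10), i.e. of the
comparison (10.14) = (10.15) via (10.16)–(10.22) and the character identity (10.8). In-tree
material towards a proof: the `D`-side trace and Hilbert–Schmidt theory
(`QuaternionUnitsTraceFormula`, `QuaternionUnitsTraceHS`, `QuaternionUnitsTraceNormalized`,
`AdelicGroupData.hasSum_norm_sq_integratedOperator_rightRegular`), the `GL₂` trace formula modulo
the parabolic terms (`GL2TraceFormulaModParabolic`), local trace adjustments
(`QuaternionLocalRamifiedTraceAdjust`, `QuaternionLocalSplitTraceAdjust`).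
[cite: Gelbart1975, (10.10)–(10.13) and (10.14)–(10.22), proof of Thm. 10.5 (i), pp. 151–156]
(Binder repair 2026-08-16: `[IsQuaternionAlgebra K D]` is written in the header so that it is a
parameter of the elaborated constant; as a section instance unused by the body it was silently
dropped, so the fact ranged over cases the printed theorem excludes.) -/
def jacquetLanglands_exists_traceComparisonDatum [IsQuaternionAlgebra K D] : Prop :=
  ∃ θ₀ : (∀ v, v ∉ ramifiedPlaces K D →
      (ScalarExtension K (v.adicCompletion K) D ≃ₐ[v.adicCompletion K]
        Matrix (Fin 2) (Fin 2) (v.adicCompletion K))),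
    ∀ (_hdiv : ∀ x : D, x ≠ 0 → IsUnit x)
      (μ_D : Measure (AdelicGroupData.units K D).automorphicQuotient)
      [(AdelicGroupData.units K D).IsAutomorphicMeasure μ_D]
      (μ : Measure (AdelicGroupData.gl 2 K).automorphicQuotient)
      [(AdelicGroupData.gl 2 K).IsAutomorphicMeasure μ]
      [∀ v : HeightOneSpectrum (𝓞 K), MeasurableSpace (GL (Fin 2) (v.adicCompletion K) ⧸
        Subgroup.center (GL (Fin 2) (v.adicCompletion K)))]
      [∀ v : HeightOneSpectrum (𝓞 K), BorelSpace (GL (Fin 2) (v.adicCompletion K) ⧸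
        Subgroup.center (GL (Fin 2) (v.adicCompletion K)))]
      (πD : DiscreteAutomorphicRep (AdelicGroupData.units K D) μ_D), ¬ πD.IsOneDimensional →
      ∃ (E : Submodule ℂ ((AdelicGroupData.gl 2 K).L2 μ))
        (B : Submodule ℂ (((AdelicGroupData.gl 2 K).L2 μ →L[ℂ] (AdelicGroupData.gl 2 K).L2 μ) ×
          ((AdelicGroupData.units K D).L2 μ_D →L[ℂ] (AdelicGroupData.units K D).L2 μ_D)))
        (ι : Type) (b : HilbertBasis ι ℂ E) (κ : Type u)
        (c : HilbertBasis κ ℂ ((AdelicGroupData.units K D).L2 μ_D)),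
        IsClosed (E : Set ((AdelicGroupData.gl 2 K).L2 μ)) ∧
        (∀ (v : HeightOneSpectrum (𝓞 K)) (_ : v ∉ ramifiedPlaces K D)
            (g : GL (Fin 2) (v.adicCompletion K)), ∀ x ∈ E,
            (AdelicGroupData.gl 2 K).rightRegular μ (GLn.ofLocal 2 K v g) x ∈ E) ∧
        (∀ f ∈ B, ∀ h ∈ B, f * h ∈ B) ∧ (∀ f ∈ B, star f ∈ B) ∧
        (∀ (v : HeightOneSpectrum (𝓞 K)) (hv : v ∉ ramifiedPlaces K D)
            (g : GL (Fin 2) (v.adicCompletion K)), ∀ f ∈ B,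
            (((AdelicGroupData.gl 2 K).rightRegular μ (GLn.ofLocal 2 K v g),
              (AdelicGroupData.units K D).rightRegular μ_D
                (Quat.ofLocal K D v ((unitsEquivOfSplitting (θ₀ v hv)).symm g))) :
              ((AdelicGroupData.gl 2 K).L2 μ →L[ℂ] (AdelicGroupData.gl 2 K).L2 μ) ×
                ((AdelicGroupData.units K D).L2 μ_D →L[ℂ] (AdelicGroupData.units K D).L2 μ_D)) *
              f ∈ B) ∧
        (∀ f ∈ B, ∀ x ∈ E, f.1 x ∈ E) ∧
        (∀ f ∈ B, ∀ x ∈ E, f.1 x ∈ cuspidalSubspace 2 K μ) ∧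
        (∀ f ∈ B, ∀ x ∈ E, ∀ π : CuspidalAutomorphicRepGL 2 K μ,
            (¬ ∀ v ∈ ramifiedPlaces K D, ∃ (V : Type) (_ : AddCommGroup V) (_ : Module ℂ V)
                (ρ : Representation ℂ (GL (Fin 2) (v.adicCompletion K)) V),
                ρ.IsIrreducible ∧ ρ.IsAdmissible ∧ HasLocalComponentAt π.1 v ρ ∧
                  ∀ (ν : Measure (GL (Fin 2) (v.adicCompletion K) ⧸
                    Subgroup.center (GL (Fin 2) (v.adicCompletion K)))) [ν.IsHaarMeasure],
                    ρ.IsSquareIntegrableModCenter ν) →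
            f.1 x ∈ π.1.toSubmoduleᗮ) ∧
        (∀ f ∈ B, ∑' j, (‖f.2 (c j)‖₊ : ℝ≥0∞) ^ 2 ≤ ∑' i, (‖f.1 (b i)‖₊ : ℝ≥0∞) ^ 2) ∧
        (∀ f ∈ B, ∑' i, (‖f.1 (b i)‖₊ : ℝ≥0∞) ^ 2 < ∞) ∧
        (∀ f ∈ B, ∀ x ∈ πD.space.toSubmodule, f.2 x ∈ πD.space.toSubmodule) ∧
        (∃ f ∈ B, ∃ x ∈ πD.space.toSubmodule, f.2 x ≠ 0)

/-- **Assembly (Gelbart (1975), proof of Thm. 10.5 (i) via Lemma 10.6): the existence half of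
Jacquet–Langlands from the trace-comparison datum.** Unpack the splittings and apply
`jacquetLanglands_transfer_exists_of_hilbertSchmidt_le_of_mapsTo_cuspidal` (Lemma 10.6 = JL
Lemma 16.1.1 cut down to `M = E ⊓ (L²_cusp ⊓ ⨅_{Π bad} Πᗮ)`, proved in the tree).
[cite: Gelbart1975, Thm. 10.5 (i) (proof), Lemma 10.6] -/
theorem jacquetLanglands_transfer_exists_holds_of
    (h : jacquetLanglands_exists_traceComparisonDatum K D) :
    jacquetLanglands_transfer_exists K D := by
  obtain ⟨θ₀, hB⟩ := h
  exact jacquetLanglands_transfer_exists_of_hilbertSchmidt_le_of_mapsTo_cuspidal K D θ₀ hB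

end Split

end Literature.NumberTheory.Automorphic

end
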